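import Summits.QuantumFields.BalabanUV.Beta.SymmetrisedDressingLinear
import Summits.QuantumFields.BalabanUV.Beta.SymmetrisedDressingReflection
import Summits.QuantumFields.BalabanUV.Beta.ChartConjugationDefectEnd

/-!
# `BalabanUV.Beta.SymmetrisedDressingHessian` — the dressed-kernel identity for the SYMMETRISED dressing (`TbalOf_dressSymAt`) and the `hR` END
# of the symmetrised-dressed family WITH COMPENSATORS, NO SOCKET (β sub-cell, row D1 OWNER b2b-balaban-beta-an2, gen 26; K5d of the «JsB12Sym»
# wiring: §7 = decl-by-decl twin of `AxialDressingRootedBmHessian` §7 with `Π_bm ↦ Π^{sym}_bm`; §8 = the COMPENSATED END of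
# `ChartConjugationDefectEnd` §2 instantiated at `G_j := coDressKSymAt ρ Lc (KInvStep Lc j)` — the shape of the hR ∧ hSX clause of R-D1-g25-4 and R-D1-g25-5)

HONEST FRAMING (cell charter, verbatim): «discharging BetaPertH makes Balaban's UV stability UNCONDITIONAL — a real
constructive-QFT result; it is NOT the continuum limit and NOT the Clay problem.»  DERIVED cell leaf; no statement of Bałaban's papers, no
`[cite:]` tag, no `Prop` fact; instantiates no wall binder: every jet law, the spread kernels `𝕄 j`, the contact families, the compensators
`Wc j α` and the cancellation `hcomp` below are HYPOTHESES (binders) of the END, never facts.  NOT D1, NOT `BetaPertH`; NOT continuum; NOT Clay.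
HONEST DEPENDENCY: continuum YM on T⁴ ⇐ BetaPertH ∧ nine spine estimates (0/9 proved); BetaPertH ⇐ (D1) ∧ (D4) ∧ CAP+tail;
G-an2-4 gates asym, D1 and NE2/3/4.

## What is here
* §7 (twins of `AxialDressingRootedBmHessian` §7) **`hessKer_dressSymAt`**: `hessKer K (vertexOfK K N (dressSymAt hr J).S) (dressSymAt hr J).W
  = hessKer G (vertexOfK G N J.S) J.W`, `G := coDressKSymAt (toSite r) N K`; `TstepOf_dressSymAt`, **`TbalOf_dressSymAt`** (d = 3),
  `decays_coDressKSymAt_KInvStep`, `shiftK_coDressKSymAt_KInvStep`.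
* §8 **`axisReflectionCovariant_flipK_TbalOf_dressSymAt_compensated`**: for UNDRESSED step jets `Js⁰` the family `fun j ↦ dressSymAt hr (Js⁰ j)`
  has `∀ j, AxisReflectionCovariant (flipK (TbalOf Lc … j))` from the BINDERS: reflection invariance `hGr` of `G_j`, spread `𝕄 j` (NO inverse
  identity between `G_j` and `𝕄 j`), contact families `C j α`, second-order contacts `X₂ j α`, COMPENSATORS `Wc j α`, the jet laws (St), (Wt),
  (Sr-conj), (Wr-conj-c) of the undressed jets against `𝕄 j`, and `hcomp` (`½·tadpole G_j (Wc …) + conjDefect G_j (𝕄 j) … = 0`);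
  **`axisReflectionCovariant_flipK_TbalOf_dressSymCtr_compensated`** — the centred family, `Odd Lc`, `hGr` DISCHARGED by
  `SymmetrisedDressingReflection.refK_coDressKSymAt_KInvStep`.
All declarations `[folklore]`; axioms standard.  Provenance: b2b-balaban β sub-cell, unit beta-an2 gen 26, 2026-08-21.
-/

open Finset
open scoped BigOperators
open Literature.MathematicalPhysics.QuantumFieldTheory
open Literature.MathematicalPhysics.QuantumFieldTheory.Balaban1983to89
open Literature.MathematicalPhysics.QuantumFieldTheory.Balaban1983to89.Beta
open B12Sec2to5 (l1 l1_nonneg)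
open ExpKernelCalculus (MKer Decays BiLoc comp tr bubble tadpole hessKer VertexFamily VertexFamily₂ shiftK l1_sub_symm)
open AffineAveraging (Form0 Form1 box toSite)
open AveragingContoursRooted (ctrOff ctrOff_mem_box)
open PolarizationSign (reflSign AxisReflectionCovariant)
open KernelReflection (LegMap refK refK_apply comp_refK)
open ResolventReflection (bref bref_apply Φ refK_KInvStep)
open OneStepResolventKernel (Fib wsum LocStencil JetData)
open OneStepKernelFamily (KInvStep decays_KInvStep shiftK_KInvStep colH vertexOfK vertexFamily_vertexOfK' TstepOf TbalOf flipK)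
open Summit.QuantumFields.BalabanUV.Beta.TameKernelCalculus
open Summit.QuantumFields.BalabanUV.Beta.AxialDressingRooted
open Summit.QuantumFields.BalabanUV.Beta.SymmetrisedDressingMatrix
open Summit.QuantumFields.BalabanUV.Beta.SymmetrisedDressingKernel
open Summit.QuantumFields.BalabanUV.Beta.SymmetrisedDressingLegs
open Summit.QuantumFields.BalabanUV.Beta.SymmetrisedDressingDress
open Summit.QuantumFields.BalabanUV.Beta.SymmetrisedDressingLinear
open Summit.QuantumFields.BalabanUV.Beta.ChartConjugation (conjV conjW)
open Summit.QuantumFields.BalabanUV.Beta.ChartConjugationDefectEnd (conjDefect axisReflectionCovariant_flipK_hessKer_conj_compensated)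
open Summit.QuantumFields.BalabanUV.Beta.SymmetrisedDressingReflection (refK_coDressKSymAt_KInvStep)

namespace Summit.QuantumFields.BalabanUV.Beta.SymmetrisedDressingHessian

noncomputable section

variable {d : ℕ}

/-! ## §7 The dressed-kernel identity for the block-mean dressing -/

section HessianBm

/-- [folklore] **THE BLOCK-MEAN DRESSING LEMMA OVER AN ARBITRARY DECAYING KERNEL `K`.**  For every decaying `K`, every jet datum `J`
and every in-block root `r`:
`hessKer K (vertexOfK K N (dressSymAt hr J).S) (dressSymAt hr J).W = hessKer G (vertexOfK G N J.S) J.W`, `G := coDressKSymAt (toSite r) N K`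
(`= Π_bm K Πᵀ_bm`).  Tadpole: `tr(K·ΠᵀWΠ) = tr(ΠKΠᵀ·W)`; bubble: `tr(K·ΠᵀV₁Π·K·ΠᵀV₂Π) = tr(G V₁ G V₂)` — tame trace cyclicity and
associativity (an5's `tr_comp_comm_loc`, `comp_assoc_tame`), every series absolutely convergent. -/
theorem hessKer_dressSymAt {N : ℕ} [NeZero N] {r : Fin (d + 1) → ℕ} (hr : r ∈ box (d + 1) N) {K : MKer (d + 1) (Fib d)}
    (hK : ∃ δ C : ℝ, 0 < δ ∧ 0 ≤ C ∧ Decays K C δ) (J : JetData d N) :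
    hessKer K (vertexOfK K N (dressSymAt hr J).S) (dressSymAt hr J).W =
      hessKer (coDressKSymAt (toSite r) N K) (vertexOfK (coDressKSymAt (toSite r) N K) N J.S) J.W := by
  have hN : 1 ≤ N := one_le_of_neZero N
  obtain ⟨δ, C, hδ, hC, hKd⟩ := hK
  -- the cast
  set P : MKer (d + 1) (Fib d) := piKSymBm (toSite r) N with hPdef
  set G : MKer (d + 1) (Fib d) := coDressKSymAt (toSite r) N K with hGdef
  have sP : Spr P := spr_piKSymBm hN hr
  have sPt : Spr (trK P) := spr_trK_piKSymBm hN hr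
  have sK : Spr K := ⟨C, δ, hδ, hKd⟩
  have sG : Spr G := spr_coDressKSymAt hN hr sK
  have sKP : Spr (comp K P) := spr_comp sK sP
  have sPtK : Spr (comp (trK P) K) := spr_comp sPt sK
  have hGd : ∃ δ C : ℝ, 0 < δ ∧ 0 ≤ C ∧ Decays G C δ := decays_coDressKSymAt hN hr ⟨δ, C, hδ, hC, hKd⟩
  obtain ⟨Cv, δv, hδv, hV⟩ := vertexFamily_vertexOfK' (N := N) hGd J.loc J.δ_pos
  have lV : ∀ μ y, Loc (vertexOfK G N J.S μ y) := fun μ y => ⟨_, _, Cv, δv, hδv, hV μ y⟩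
  have lW : ∀ μ y ν y', Loc (J.W μ y ν y') := fun μ y ν y' => ⟨_, _, J.Cw, J.δ, J.δ_pos, J.loc₂ μ y ν y'⟩
  -- G = Pᵀ (K P) (re-association of its definition)
  have hG' : comp (trK P) (comp K P) = G := by
    rw [hGdef, coDressKSymAt_eq, comp_assoc_tame sPt.tame sK.tame sP.tame]
  -- TADPOLE HALF
  have htad : ∀ W : MKer (d + 1) (Fib d), Loc W →
      tadpole K (dressKSymAt (toSite r) N W) = tadpole G W := by
    intro W lW
    have lPW : Loc (comp P W) := sP.comp_loc lW
    have lPWPt : Loc (comp (comp P W) (trK P)) := lPW.comp_spr sPt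
    unfold ExpKernelCalculus.tadpole
    rw [show dressKSymAt (toSite r) N W = comp (comp P W) (trK P) from rfl]
    calc tr (comp K (comp (comp P W) (trK P)))
        = tr (comp (comp (comp P W) (trK P)) K) := (tr_comp_comm_loc lPWPt sK.tame).symm
      _ = tr (comp (comp P W) (comp (trK P) K)) := by rw [← comp_assoc_tame lPW.tame sPt.tame sK.tame]
      _ = tr (comp (comp (trK P) K) (comp P W)) := tr_comp_comm_loc lPW sPtK.tame
      _ = tr (comp (comp (comp (trK P) K) P) W) := by rw [comp_assoc_tame sPtK.tame sP.tame lW.tame]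
      _ = tr (comp G W) := by rw [hGdef, coDressKSymAt_eq]
  -- BUBBLE HALF
  have hbub : ∀ V₁ V₂ : MKer (d + 1) (Fib d), Loc V₁ → Loc V₂ →
      bubble K (dressKSymAt (toSite r) N V₁) (dressKSymAt (toSite r) N V₂) = bubble G V₁ V₂ := by
    intro V₁ V₂ l₁ l₂
    -- step 1: `K (P V Pᵀ) = ((K P) V) Pᵀ`
    have e1 : ∀ V : MKer (d + 1) (Fib d), Loc V → comp K (comp (comp P V) (trK P)) = comp (comp (comp K P) V) (trK P) := by
      intro V lV'
      rw [comp_assoc_tame sK.tame (sP.comp_loc lV').tame sPt.tame, comp_assoc_tame sK.tame sP.tame lV'.tame]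
    have lA₁ : Loc (comp (comp K P) V₁) := sKP.comp_loc l₁
    have lA₂ : Loc (comp (comp K P) V₂) := sKP.comp_loc l₂
    have lA₂Pt : Loc (comp (comp (comp K P) V₂) (trK P)) := lA₂.comp_spr sPt
    have lPtA₂ : Loc (comp (trK P) (comp (comp K P) V₂)) := sPt.comp_loc lA₂
    have lA₁PtA₂ : Loc (comp (comp (comp K P) V₁) (comp (trK P) (comp (comp K P) V₂))) := lA₁.comp lPtA₂
    -- step 3: `Pᵀ ((K P) V) = G V`
    have e3 : ∀ V : MKer (d + 1) (Fib d), Loc V → comp (trK P) (comp (comp K P) V) = comp G V := by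
      intro V lV'
      rw [comp_assoc_tame sPt.tame sKP.tame lV'.tame, hG']
    unfold ExpKernelCalculus.bubble
    rw [show dressKSymAt (toSite r) N V₁ = comp (comp P V₁) (trK P) from rfl,
      show dressKSymAt (toSite r) N V₂ = comp (comp P V₂) (trK P) from rfl, e1 V₁ l₁, e1 V₂ l₂]
    calc tr (comp (comp (comp (comp K P) V₁) (trK P)) (comp (comp (comp K P) V₂) (trK P)))
        = tr (comp (comp (comp K P) V₁) (comp (trK P) (comp (comp (comp K P) V₂) (trK P)))) := by
          rw [← comp_assoc_tame lA₁.tame sPt.tame lA₂Pt.tame]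
      _ = tr (comp (comp (comp K P) V₁) (comp (comp (trK P) (comp (comp K P) V₂)) (trK P))) := by
          rw [comp_assoc_tame sPt.tame lA₂.tame sPt.tame]
      _ = tr (comp (comp (comp (comp K P) V₁) (comp (trK P) (comp (comp K P) V₂))) (trK P)) := by
          rw [comp_assoc_tame lA₁.tame lPtA₂.tame sPt.tame]
      _ = tr (comp (trK P) (comp (comp (comp K P) V₁) (comp (trK P) (comp (comp K P) V₂)))) :=
          tr_comp_comm_loc lA₁PtA₂ sPt.tame
      _ = tr (comp (comp (trK P) (comp (comp K P) V₁)) (comp (trK P) (comp (comp K P) V₂))) := by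
          rw [comp_assoc_tame sPt.tame lA₁.tame lPtA₂.tame]
      _ = tr (comp (comp G V₁) (comp G V₂)) := by rw [e3 V₁ l₁, e3 V₂ l₂]
  -- ASSEMBLY
  funext μ ν z
  show (1 / 2) * tadpole K ((dressSymAt hr J).W μ 0 ν z) -
      (1 / 2) * bubble K (vertexOfK K N (dressSymAt hr J).S μ 0) (vertexOfK K N (dressSymAt hr J).S ν z) =
    (1 / 2) * tadpole G (J.W μ 0 ν z) - (1 / 2) * bubble G (vertexOfK G N J.S μ 0) (vertexOfK G N J.S ν z)
  rw [dressSymAt_W, vertexOfK_dressSymAt_S hr hKd hδ, vertexOfK_dressSymAt_S hr hKd hδ, ← hGdef, htad _ (lW μ 0 ν z),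
    hbub _ _ (lV μ 0) (lV ν z)]

/-- [folklore] **THE DRESSED-KERNEL IDENTITY FOR THE STEP KERNELS (every step `j`).**  The typed step-`j` kernel
(`OneStepKernelFamily.TstepOf`) of the block-mean-dressed jets is the resolvent Hessian kernel of the CO-DRESSED decimated composite
resolvent `G_j := coDressKSymAt ρ Lc (KInvStep Lc j)` with the chain-rule vertex through ITS `ℋ`-column and the UNDRESSED jets:
`TstepOf Lc j (dressSymAt hr J) = hessKer G_j (vertexOfK G_j Lc J.S) J.W` — the shape of
`ChartConjugationEnd.axisReflectionCovariant_flipK_hessKer_conj` with `K := G_j` (X-an2-41 §4 (ii-0)). -/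
theorem TstepOf_dressSymAt {Lc : ℕ} [NeZero Lc] {r : Fin (d + 1) → ℕ} (hr : r ∈ box (d + 1) Lc) (j : ℕ) (J : JetData d Lc) :
    TstepOf Lc j (dressSymAt hr J) =
      hessKer (coDressKSymAt (toSite r) Lc (KInvStep (d := d) Lc j))
        (vertexOfK (coDressKSymAt (toSite r) Lc (KInvStep (d := d) Lc j)) Lc J.S) J.W := by
  unfold TstepOf
  exact hessKer_dressSymAt hr (decays_KInvStep (d := d) (Lc := Lc) j) J

/-- [folklore] **THE WALL FAMILY'S KERNELS IN CO-DRESSED FORM (dimension four, every `j`).**  For ANY step jet data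
`Js : ℕ → JetData 3 Lc` and any in-block root: `TbalOf Lc (fun j ↦ dressSymAt hr (Js j)) j = hessKer G_j (vertexOfK G_j Lc (Js j).S) (Js j).W`.
(The ρ-threaded spine `SpineRooted.JsBalAtOf … = dressSymAt hr ∘ JsBal0AtOf …` is of this form.) -/
theorem TbalOf_dressSymAt {Lc : ℕ} [NeZero Lc] {r : Fin 4 → ℕ} (hr : r ∈ box 4 Lc) (Js : ℕ → JetData 3 Lc) (j : ℕ) :
    TbalOf Lc (fun j => dressSymAt hr (Js j)) j =
      hessKer (coDressKSymAt (toSite r) Lc (KInvStep (d := 3) Lc j))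
        (vertexOfK (coDressKSymAt (toSite r) Lc (KInvStep (d := 3) Lc j)) Lc (Js j).S) (Js j).W :=
  TstepOf_dressSymAt hr j (Js j)

/-- [folklore] The kernel-side hypotheses `hKd` / `hKs` of the `ChartConjugationEnd` ENDs hold for `G_j`: it decays … -/
theorem decays_coDressKSymAt_KInvStep {Lc : ℕ} [NeZero Lc] {r : Fin (d + 1) → ℕ} (hr : r ∈ box (d + 1) Lc) (j : ℕ) :
    ∃ δ C : ℝ, 0 < δ ∧ 0 ≤ C ∧ Decays (coDressKSymAt (toSite r) Lc (KInvStep (d := d) Lc j)) C δ :=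
  decays_coDressKSymAt (one_le_of_neZero Lc) hr (decays_KInvStep (d := d) (Lc := Lc) j)

/-- [folklore] … and is block-translation invariant under the `Lc`-translations of the step-`j` lattice. -/
theorem shiftK_coDressKSymAt_KInvStep {Lc : ℕ} [NeZero Lc] (ρ : Fin (d + 1) → ℤ) (j : ℕ) (t : Fin (d + 1) → ℤ) :
    shiftK (-((Lc : ℤ) • t)) (coDressKSymAt ρ Lc (KInvStep (d := d) Lc j)) = coDressKSymAt ρ Lc (KInvStep (d := d) Lc j) :=
  shiftK_coDressKSymAt ρ (one_le_of_neZero Lc) (shiftK_KInvStep (d := d) (Lc := Lc) j) t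

end HessianBm

/-! ## §8 The `hR` ENDs for the symmetrised-dressed family WITH COMPENSATORS — no socket -/

section EndSym

/-- [folklore] **THE `hR` BINDER FOR THE SYMMETRISED-DRESSED WALL FAMILY, WITH COMPENSATORS, NO SOCKET** (the sym twin of
`AxialDressingRootedBmHessian.axisReflectionCovariant_flipK_TbalOf_dressBmAt_rel`, built on `ChartConjugationDefectEnd` §2 instead of the
relative END).  For UNDRESSED step jets `Js⁰ : ℕ → JetData 3 Lc` and an in-block root `r`, the family `fun j ↦ dressSymAt hr (Js⁰ j)` has
`∀ j, AxisReflectionCovariant (flipK (TbalOf Lc … j))` from the BINDERS: reflection invariance `hGr` of `G_j := coDressKSymAt (toSite r) Lc (KInvStep Lc j)`,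
a spread `𝕄 j` (NO inverse identity between `G_j` and `𝕄 j`), contact families `C j α`, second-order contacts `X₂ j α`, localised COMPENSATORS
`Wc j α`, the jet laws (St), (Wt), (Sr-conj), (Wr-conj-c) of the UNDRESSED jets against `𝕄 j`, and the cancellation
`hcomp : ½·tadpole G_j (Wc j α μ y ν y′) + conjDefect G_j (𝕄 j) (…) = 0` (the typed interface of the hSX binder, R-D1-g25-4).
Proof: `TbalOf_dressSymAt` + `ChartConjugationDefectEnd.axisReflectionCovariant_flipK_hessKer_conj_compensated`.  Discharges nothing by itself. -/
theorem axisReflectionCovariant_flipK_TbalOf_dressSymAt_compensated {Lc : ℕ} [NeZero Lc] {r : Fin 4 → ℕ} (hr : r ∈ box 4 Lc)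
    (Js : ℕ → JetData 3 Lc) (M : ℕ → MKer 4 (Fib 3))
    (hGr : ∀ (j : ℕ) (α : Fin 4), refK (Φ Lc α) (coDressKSymAt (toSite r) Lc (KInvStep (d := 3) Lc j)) =
      coDressKSymAt (toSite r) Lc (KInvStep (d := 3) Lc j))
    (hM : ∀ j, Spr (M j))
    (hSt : ∀ (j : ℕ) (κ' : Fin 4) (u t : Fin 4 → ℤ), (Js j).S κ' (u + (Lc : ℤ) • t) = ExpKernelCalculus.shiftK (-((Lc : ℤ) • t)) ((Js j).S κ' u))
    (hWt : ∀ (j : ℕ) (μ : Fin 4) (y : Fin 4 → ℤ) (ν : Fin 4) (y' t : Fin 4 → ℤ),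
      (Js j).W μ (y + t) ν (y' + t) = ExpKernelCalculus.shiftK (-((Lc : ℤ) • t)) ((Js j).W μ y ν y'))
    (C : ℕ → Fin 4 → Fin 4 → (Fin 4 → ℤ) → MKer 4 (Fib 3)) (Cc δc : ℕ → ℝ) (hC : ∀ j α, LocStencil (C j α) (Cc j) (δc j))
    (hδc : ∀ j, 0 < δc j) (X₂ Wc : ℕ → Fin 4 → Fin 4 → (Fin 4 → ℤ) → Fin 4 → (Fin 4 → ℤ) → MKer 4 (Fib 3))
    (hX₂ : ∀ j α μ y ν y', Loc (X₂ j α μ y ν y')) (hWc : ∀ j α μ y ν y', Loc (Wc j α μ y ν y'))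
    (hSrC : ∀ (j : ℕ) (α κ' : Fin 4) (u : Fin 4 → ℤ),
      (Js j).S κ' (bref α κ' u) = reflSign α κ' • refK (Φ Lc α) ((Js j).S κ' u + conjV (M j) (C j α κ' u)))
    (hWrC : ∀ (j : ℕ) (α μ : Fin 4) (y : Fin 4 → ℤ) (ν : Fin 4) (y' : Fin 4 → ℤ),
      (Js j).W μ (bref α μ y) ν (bref α ν y') = (reflSign α μ * reflSign α ν) • refK (Φ Lc α) ((Js j).W μ y ν y' +
        conjW (M j) (vertexOfK (coDressKSymAt (toSite r) Lc (KInvStep (d := 3) Lc j)) Lc (Js j).S μ y)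
          (vertexOfK (coDressKSymAt (toSite r) Lc (KInvStep (d := 3) Lc j)) Lc (Js j).S ν y')
          (vertexOfK (coDressKSymAt (toSite r) Lc (KInvStep (d := 3) Lc j)) Lc (C j α) μ y)
          (vertexOfK (coDressKSymAt (toSite r) Lc (KInvStep (d := 3) Lc j)) Lc (C j α) ν y') (X₂ j α μ y ν y') + Wc j α μ y ν y'))
    (hcomp : ∀ (j : ℕ) (α μ : Fin 4) (y : Fin 4 → ℤ) (ν : Fin 4) (y' : Fin 4 → ℤ),
      (1 / 2 : ℝ) * tadpole (coDressKSymAt (toSite r) Lc (KInvStep (d := 3) Lc j)) (Wc j α μ y ν y')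
        + conjDefect (coDressKSymAt (toSite r) Lc (KInvStep (d := 3) Lc j)) (M j)
            (vertexOfK (coDressKSymAt (toSite r) Lc (KInvStep (d := 3) Lc j)) Lc (Js j).S μ y)
            (vertexOfK (coDressKSymAt (toSite r) Lc (KInvStep (d := 3) Lc j)) Lc (Js j).S ν y')
            (vertexOfK (coDressKSymAt (toSite r) Lc (KInvStep (d := 3) Lc j)) Lc (C j α) μ y)
            (vertexOfK (coDressKSymAt (toSite r) Lc (KInvStep (d := 3) Lc j)) Lc (C j α) ν y') (X₂ j α μ y ν y') = 0) :
    ∀ j : ℕ, AxisReflectionCovariant (flipK (TbalOf Lc (fun j => dressSymAt hr (Js j)) j)) := by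
  intro j
  rw [TbalOf_dressSymAt hr Js j]
  exact axisReflectionCovariant_flipK_hessKer_conj_compensated (decays_coDressKSymAt_KInvStep hr j)
    (shiftK_coDressKSymAt_KInvStep (toSite r) j) (hGr j) (hM j) (Js j) (hSt j) (hWt j) (C j) (hC j) (hδc j) (X₂ j) (Wc j)
    (hX₂ j) (hWc j) (hSrC j) (hWrC j) (hcomp j)

/-- [folklore] **THE `hR` BINDER FOR THE CENTRED SYMMETRISED-DRESSED WALL FAMILY, `Odd Lc` — `hGr` DISCHARGED** (by
`SymmetrisedDressingReflection.refK_coDressKSymAt_KInvStep`).  Remaining BINDERS: spread `𝕄 j`; contact families, second-order contacts,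
compensators; the undressed jet laws; `hcomp`. -/
theorem axisReflectionCovariant_flipK_TbalOf_dressSymCtr_compensated {Lc : ℕ} [NeZero Lc] (hLc : Odd Lc) (Js : ℕ → JetData 3 Lc)
    (M : ℕ → MKer 4 (Fib 3)) (hM : ∀ j, Spr (M j))
    (hSt : ∀ (j : ℕ) (κ' : Fin 4) (u t : Fin 4 → ℤ), (Js j).S κ' (u + (Lc : ℤ) • t) = ExpKernelCalculus.shiftK (-((Lc : ℤ) • t)) ((Js j).S κ' u))
    (hWt : ∀ (j : ℕ) (μ : Fin 4) (y : Fin 4 → ℤ) (ν : Fin 4) (y' t : Fin 4 → ℤ),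
      (Js j).W μ (y + t) ν (y' + t) = ExpKernelCalculus.shiftK (-((Lc : ℤ) • t)) ((Js j).W μ y ν y'))
    (C : ℕ → Fin 4 → Fin 4 → (Fin 4 → ℤ) → MKer 4 (Fib 3)) (Cc δc : ℕ → ℝ) (hC : ∀ j α, LocStencil (C j α) (Cc j) (δc j))
    (hδc : ∀ j, 0 < δc j) (X₂ Wc : ℕ → Fin 4 → Fin 4 → (Fin 4 → ℤ) → Fin 4 → (Fin 4 → ℤ) → MKer 4 (Fib 3))
    (hX₂ : ∀ j α μ y ν y', Loc (X₂ j α μ y ν y')) (hWc : ∀ j α μ y ν y', Loc (Wc j α μ y ν y'))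
    (hSrC : ∀ (j : ℕ) (α κ' : Fin 4) (u : Fin 4 → ℤ),
      (Js j).S κ' (bref α κ' u) = reflSign α κ' • refK (Φ Lc α) ((Js j).S κ' u + conjV (M j) (C j α κ' u)))
    (hWrC : ∀ (j : ℕ) (α μ : Fin 4) (y : Fin 4 → ℤ) (ν : Fin 4) (y' : Fin 4 → ℤ),
      (Js j).W μ (bref α μ y) ν (bref α ν y') = (reflSign α μ * reflSign α ν) • refK (Φ Lc α) ((Js j).W μ y ν y' +
        conjW (M j) (vertexOfK (coDressKSymAt (toSite (ctrOff 4 Lc)) Lc (KInvStep (d := 3) Lc j)) Lc (Js j).S μ y)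
          (vertexOfK (coDressKSymAt (toSite (ctrOff 4 Lc)) Lc (KInvStep (d := 3) Lc j)) Lc (Js j).S ν y')
          (vertexOfK (coDressKSymAt (toSite (ctrOff 4 Lc)) Lc (KInvStep (d := 3) Lc j)) Lc (C j α) μ y)
          (vertexOfK (coDressKSymAt (toSite (ctrOff 4 Lc)) Lc (KInvStep (d := 3) Lc j)) Lc (C j α) ν y') (X₂ j α μ y ν y')
          + Wc j α μ y ν y'))
    (hcomp : ∀ (j : ℕ) (α μ : Fin 4) (y : Fin 4 → ℤ) (ν : Fin 4) (y' : Fin 4 → ℤ),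
      (1 / 2 : ℝ) * tadpole (coDressKSymAt (toSite (ctrOff 4 Lc)) Lc (KInvStep (d := 3) Lc j)) (Wc j α μ y ν y')
        + conjDefect (coDressKSymAt (toSite (ctrOff 4 Lc)) Lc (KInvStep (d := 3) Lc j)) (M j)
            (vertexOfK (coDressKSymAt (toSite (ctrOff 4 Lc)) Lc (KInvStep (d := 3) Lc j)) Lc (Js j).S μ y)
            (vertexOfK (coDressKSymAt (toSite (ctrOff 4 Lc)) Lc (KInvStep (d := 3) Lc j)) Lc (Js j).S ν y')
            (vertexOfK (coDressKSymAt (toSite (ctrOff 4 Lc)) Lc (KInvStep (d := 3) Lc j)) Lc (C j α) μ y)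
            (vertexOfK (coDressKSymAt (toSite (ctrOff 4 Lc)) Lc (KInvStep (d := 3) Lc j)) Lc (C j α) ν y') (X₂ j α μ y ν y') = 0) :
    ∀ j : ℕ, AxisReflectionCovariant
      (flipK (TbalOf Lc (fun j => dressSymAt (ctrOff_mem_box (d := 4) (one_le_of_neZero Lc)) (Js j)) j)) :=
  axisReflectionCovariant_flipK_TbalOf_dressSymAt_compensated (ctrOff_mem_box (d := 4) (one_le_of_neZero Lc)) Js M
    (fun j α => refK_coDressKSymAt_KInvStep (d := 3) hLc j α) hM hSt hWt C Cc δc hC hδc X₂ Wc hX₂ hWc hSrC hWrC hcomp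

end EndSym


end

end Summit.QuantumFields.BalabanUV.Beta.SymmetrisedDressingHessian
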